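import Summits.BirchSwinnertonDyer.BirchSwinnertonDyer.Theorems.KolyvaginDepthDoorMSymbolCert389a1Odd
import Summits.BirchSwinnertonDyer.BirchSwinnertonDyer.Theorems.KolyvaginDepthDoorDepthTableKuriharaRow389a1CertifiedE
import Summits.BirchSwinnertonDyer.BirchSwinnertonDyer.Theorems.KatoDescentTamePotSupersingularTameUpperUnitTwistRecordToolsConductor
import Literature.NumberTheory.EllipticCurves.CuspFormTwistRatPlusSymbolOdd
import Literature.NumberTheory.EllipticCurves.QuadraticTwistKroneckerLFunctionProofs
import Literature.NumberTheory.QuadraticFields.JacobiCharacterPrimitiveProofs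
import Literature.NumberTheory.EllipticCurves.LFunctionSmulProofs
import Literature.NumberTheory.EllipticCurves.ModularityVersionApProofs
import HarnessLib

/-!
# Route `KolyvaginDepthDoor`, crux `KolyvaginDepthSupplyKN` (stmt-BirchSwinnertonDyer-22820) —
# DEPTH TABLE v27, TWIST SIDE: the plus symbols of the newform of `19061a1 = 389a1 ⊗ χ₋₇` from the CERTIFIED
# minus M-symbol of `389a1` (`[r]⁺_{f⊗χ} = c ∑_u χ(u) [r + u/7]⁻_f`, Mazur–Tate–Teitelbaum §I.8)

Helper file of the lead prover of line `levelone` (kdd-p1 g31; `--supports stmt-BirchSwinnertonDyer-22820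
--as helper`); it closes nothing and BSD is NOT proved by it.

The twist-side Kurihara claim `hδT` of row `389a1` concerns the newform of `T₀ = [0,-1,1,-114,-302]`
(`19061a1`, the minimal model of `389a1^{(-7)}`, `C389a1.minTwist7_smul_eq`) at level `N_{T₀}`. Kit 1 indexes
M-symbols at PRIME level only, and `19061 = 389·7²` is composite; instead:
* `conductorNorm_T0`: `N_{T₀} = 19061` (kernel: Tate exponents `f₇ = 2`, `f₃₈₉ = 1` via the tree's
  `conductorNorm_eq_of_exponents`).
* `LFunction_T0`: `aₙ(T₀) = (n/7) aₙ(389a1)` (the tree's `LFunction_quadraticTwist_apply_of_emod_four_eq_one` at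
  `D = -7` + `LFunction_smul`), hence `newform_T0_eq_charTwist`: the newform of `T₀` at level `19061` IS the
  tree's twist `charTwist 19061 … (jacobiChar 7) f₀` of the newform `f₀` of `389a1` (q-expansion principle
  `eq_of_forall_cuspCoeff_eq_gamma0`; `cuspCoeff_charTwist`).
* `exists_ratMinusSymbol_const`: `[y]⁻_{f₀} ∈ K₀ ℤ` for every rational `y`, and `[a/n]⁻_{f₀} = K₀ · S⁻(a/n)` on
  Bezout data (the odd certificate `…MSymbolCert389a1Odd`, applied to `f₀` given by `IsNewformOf` only).
* `exists_const_T0`: ONE rational `C` with `[r]⁺_g ∈ C ℤ` for every `r` and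
  `[a/211]⁺_g = C · sigmaT a` for `0 < a < 211`, where `g` is the newform of `T₀` and `sigmaT a` is the
  kernel-computable integer `∑_{u=1}^{6} (u/7) S⁻((7a + 211u)/1477)` (`CuspFormTwistRatPlusSymbolOdd`'s
  `exists_rat_forall_ratPlusSymbol_charTwist_eq_of_odd` for the odd primitive quadratic `jacobiChar 7`).
Modularity of `389a1` (the existence of `f₀` at level `389`) enters as the row's own hypothesis
`exists_isNewformOf` (`hnf`). The unit property of `C` and the Kurihara number of `T₀` at `(5, 211)` are in the
sibling `…KuriharaRow389a1CertifiedT`.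

References: [MazurTateTeitelbaum1986Invent] §I.8; [Shimura1971] Prop. 3.64; [CremonaAlgorithms1997] §2.8,
Table 1 (389a1); [SilvermanAEC2009] App. C §16 (conductor).
-/

set_option linter.dupNamespace false

noncomputable section

open scoped MatrixGroups ModularForm
open CongruenceSubgroup
open Literature.NumberTheory.EllipticCurves Literature.NumberTheory.EllipticCurves.ModularForms
open Literature.NumberTheory.QuadraticFields
open Summit.BirchSwinnertonDyer.BirchSwinnertonDyer.Rank2Observatory
open Summit.BirchSwinnertonDyer.BirchSwinnertonDyer.Theorems.TameUpperUnitTwistRecords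
  (conductorNorm_eq_of_exponents conductorExponent_natPlace_eq_two_of_five_le
    conductorExponent_natPlace_eq_one_of_dvd_of_not_dvd)
open Summit.BirchSwinnertonDyer.BirchSwinnertonDyer.Rank1Residual (IntModel.frobeniusTrace_eq)

namespace Summit.BirchSwinnertonDyer.BirchSwinnertonDyer.Theorems.KolyvaginDepthDoor.MSymbolCert.Cert389a1

/-! ## §1 `T₀ = 19061a1` and its conductor -/

/-- The minimal model `T₀ = [0, -1, 1, -114, -302]` of `389a1^{(-7)}` (Cremona `19061a1`). [cite: CremonaAlgorithms1997, Table 1 (389a1)] -/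
abbrev T0 : WeierstrassCurve ℚ := (⟨0, -1, 1, -114, -302⟩ : WeierstrassCurve ℤ).map (Int.castRingHom ℚ)

/-- **`N(T₀) = 19061 = 7² · 389`** (kernel: `Δ(T₀) = 7⁶ · 389`, `7 ∣ c₄ = 5488` so `f₇ = 2`, `389 ∤ c₄` so
`f₃₈₉ = 1`; the tree's `conductorNorm_eq_of_exponents`). [cite: SilvermanAEC2009, App. C §16] -/
theorem conductorNorm_T0 : haveI := C389a1.minTwist7_isElliptic; T0.conductorNorm ℤ = 19061 := by
  haveI := C389a1.minTwist7_isElliptic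
  haveI := C389a1.minTwist7_isGloballyMinimal
  have hI := C389a1.minTwist7_intModel
  have h := conductorNorm_eq_of_exponents hI (G := [(7, 6), (389, 1)]) (by decide +kernel)
    (by intro qe hqe; simp only [List.mem_cons, List.not_mem_nil, or_false] at hqe
        rcases hqe with rfl | rfl <;> norm_num)
    [(7, 2), (389, 1)]
    (by intro qf hqf; simp only [List.mem_cons, List.not_mem_nil, or_false] at hqf
        rcases hqf with rfl | rfl <;> norm_num)
    (by decide) (by decide)
    (by
      intro qf hqf
      simp only [List.mem_cons, List.not_mem_nil, or_false] at hqf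
      rcases hqf with rfl | rfl
      · exact conductorExponent_natPlace_eq_two_of_five_le hI (by norm_num) (by norm_num) (n := 6) (by norm_num)
          (by decide +kernel) (by decide +kernel) (by norm_num) (by decide +kernel)
      · exact conductorExponent_natPlace_eq_one_of_dvd_of_not_dvd hI (by norm_num) (by decide +kernel) (by decide +kernel))
  rw [h]; norm_num

/-! ## §2 The twisting character `χ₋₇ = (·/7)` -/

/-- `(·/7)` is odd (`(−1/7) = −1`). [folklore] -/
theorem jacobiChar_seven_odd : (jacobiChar 7).Odd := by
  rw [DirichletCharacter.Odd, show (-1 : ZMod 7) = ((6 : ℕ) : ZMod 7) by decide, jacobiChar_natCast]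
  have : jacobiSym 6 7 = -1 := by norm_num
  rw [show ((6 : ℕ) : ℤ) = 6 by rfl, this]; simp

/-- `(·/7)` is primitive (`7` odd squarefree). [folklore] -/
theorem jacobiChar_seven_isPrimitive : (jacobiChar 7).IsPrimitive :=
  isPrimitive_jacobiChar (by decide) (Nat.prime_iff.mp (by norm_num)).squarefree

/-! ## §3 The Dirichlet coefficients of `T₀` -/

/-- **`aₙ(T₀) = (n/7) · aₙ(389a1)`** (`T₀ ≅ 389a1^{(-7)}`, `-7 ≡ 1 (mod 4)`, `389a1` good at `7`).
[cite: SilvermanAEC2009, X.5 Cor. 5.4] -/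
theorem LFunction_T0 (n : ℕ) :
    haveI := C389a1.minTwist7_isElliptic; (T0.LFunction n : ℂ) = jacobiChar 7 n * (Curve389a1.E.LFunction n : ℂ) := by
  haveI := C389a1.minTwist7_isElliptic
  haveI := curve389a1_isGloballyMinimal
  have hsmul := WeierstrassCurve.LFunction_smul T0 (⟨1, (-2 : ℚ), (0 : ℚ), -((1 : ℚ) / 2)⟩ : WeierstrassCurve.VariableChange ℚ)
  rw [C389a1.minTwist7_smul_eq] at hsmul
  have hgood : ∀ v : IsDedekindDomain.HeightOneSpectrum (NumberField.RingOfIntegers ℚ),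
      ((Rat.HeightOneSpectrum.primesEquiv v : ℕ) : ℤ) ∣ (-7 : ℤ) → Curve389a1.E.HasGoodReductionAt v := by
    intro v hv
    by_contra hbad
    have hdvdN : (Rat.HeightOneSpectrum.primesEquiv v : ℕ) ∣ Curve389a1.E.conductorNorm ℤ :=
      (Curve389a1.E.dvd_conductorNorm_iff v).mpr hbad
    rw [C389a1.conductorNorm_eq] at hdvdN
    have h7 : (Rat.HeightOneSpectrum.primesEquiv v : ℕ) ∣ 7 := by
      have : ((Rat.HeightOneSpectrum.primesEquiv v : ℕ) : ℤ) ∣ ((7 : ℕ) : ℤ) := by simpa using hv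
      exact_mod_cast this
    have hp := (Rat.HeightOneSpectrum.primesEquiv v).2
    have h7' : (Rat.HeightOneSpectrum.primesEquiv v : ℕ) = 7 :=
      (Nat.prime_dvd_prime_iff_eq hp (by norm_num)).mp h7
    rw [h7'] at hdvdN
    norm_num at hdvdN
  have hsq : Squarefree (-7 : ℤ) := by
    rw [← Int.squarefree_natAbs]
    exact (Nat.prime_iff.mp (by norm_num : Nat.Prime 7)).squarefree
  have htw := Curve389a1.E.LFunction_quadraticTwist_apply_of_emod_four_eq_one (D := -7) (by decide) hsq hgood n
  rw [show (((-7 : ℤ) : ℚ)) = (-7 : ℚ) by norm_num] at htw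
  rw [← hsmul, htw, jacobiChar_natCast]
  push_cast
  rfl

/-! ## §4 The newform of `T₀` is the twist of the newform of `389a1` -/

/-- `389 ∣ 19061`. [folklore] -/
theorem dvd_19061 : 389 ∣ 19061 := by norm_num

/-- `7² ∣ 19061`. [folklore] -/
theorem sq_dvd_19061 : 7 ^ 2 ∣ 19061 := by norm_num

/-- **The newform of `T₀` at level `19061` is `f₀ ⊗ χ₋₇`** for the newform `f₀` of `389a1` (both have Dirichlet
coefficients `(n/7) aₙ(389a1)`; q-expansion principle). [cite: Shimura1971, Prop. 3.64] -/
theorem newform_T0_eq_charTwist (f₀ : CuspForm (Gamma0 389) 2) (hf₀ : IsNewformOf Curve389a1.E f₀)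
    (g : CuspForm (Gamma0 19061) 2) (hg : haveI := C389a1.minTwist7_isElliptic; IsNewformOf T0 g) :
    g = charTwist 19061 dvd_19061 sq_dvd_19061 (isQuadratic_jacobiChar (q := 7)) f₀ := by
  refine eq_of_forall_cuspCoeff_eq_gamma0 fun n => ?_
  rw [cuspCoeff_charTwist _ _ _ _ jacobiChar_seven_isPrimitive, hf₀.2 n, hg.2 n, LFunction_T0]

/-! ## §5 The minus symbols of the newform of `389a1` (from the certified odd eigenvector) -/

/-- `T₃ f₀ = -2 f₀` for the newform of `389a1` at level `389`. [cite: CremonaAlgorithms1997, Table 1 (389a1)] -/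
theorem heckeT3_of_isNewformOf (f₀ : CuspForm (Gamma0 389) 2) (hf₀ : IsNewformOf Curve389a1.E f₀) :
    heckeTnGamma0 389 2 3 f₀ = ((-2 : ℝ) : ℂ) • f₀ := by
  haveI : Fact (Nat.Prime 3) := ⟨by norm_num⟩
  haveI : NeZero (3 : ℕ) := ⟨by norm_num⟩
  haveI := curve389a1_isGloballyMinimal
  have hgood : Curve389a1.E.HasGoodReductionAtPrime 3 :=
    (goodOrdinary_of_intModel_certificate C389a1.intModel 3 (by decide +kernel) (n := 6) C389a1.card_3
      (by decide +kernel)).1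
  have hc : cuspCoeff f₀ 3 = (Curve389a1.E.frobeniusTrace 3 : ℂ) :=
    cuspCoeff_eq_frobeniusTrace_of_isNewformOf_holds hf₀ hgood
  have htr : Curve389a1.E.frobeniusTrace 3 = -2 := by
    rw [IntModel.frobeniusTrace_eq C389a1.intModel C389a1.card_3]; norm_num
  rw [heckeTnGamma0_prime 389 2 3 (by norm_num), IsNewform0.heckeT_eq_coeff_smul hf₀.1 (by norm_num),
    show (PowerSeries.coeff 3) (UpperHalfPlane.qExpansion 1 ⇑f₀) = cuspCoeff f₀ 3 from rfl, hc, htr]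
  push_cast
  rfl

/-- **`[y]⁻_{f₀} ∈ K₀ ℤ` and `[a/n]⁻_{f₀} = K₀ · S⁻(a/n)`** for the newform `f₀` of `389a1`, ONE rational `K₀`:
the certified odd eigenvector (`certOdd389_check`, `poolOdd_holds`, kit 5), periodicity for integral `y`.
[cite: MazurTateTeitelbaum1986Invent, §I.8] -/
theorem exists_ratMinusSymbol_const (f₀ : CuspForm (Gamma0 389) 2) (hf₀ : IsNewformOf Curve389a1.E f₀) :
    ∃ K₀ : ℚ, (∀ y : ℚ, ∃ k : ℤ, ratMinusSymbol f₀ y = K₀ * k) ∧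
      ∀ (a w : ℤ) (n : ℕ), 0 < n → a * w % n = 1 → ∀ fuel : ℕ, n < fuel →
        ratMinusSymbol f₀ ((a : ℚ) / n) = K₀ * chainSum 389 phim389 fuel n w := by
  have hreal : ∀ m, (cuspCoeff f₀ m).im = 0 := cuspCoeff_im_eq_zero_of_coeffField_eq_bot hf₀.coeffField_eq_bot
  have hF : ∀ k < 1560, eval (Ψm f₀) (genOdd389 k) = 0 := fun k _ =>
    poolOdd_holds f₀ hreal (heckeT3_of_isNewformOf f₀ hf₀) k
  obtain ⟨t, ht⟩ := exists_eq_smul_of_checkF certOdd389 genOdd389 1560 390 phim389 certOdd389_check (Ψm f₀) hF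
  obtain ⟨g, ε, hg, hε, hval⟩ :=
    exists_ratMinusSymbol_eq f₀ hf₀.1 hf₀.coeffField_eq_bot (fun i hi => ht i (by omega))
  refine ⟨(ε : ℚ) / (2 * g), fun y => ?_, fun a w n hn hw fuel hfuel => by rw [hval a w n hn hw fuel hfuel]; ring⟩
  by_cases hden : y.den = 1
  · refine ⟨0, ?_⟩
    have hy : y = ((y.num : ℚ)) := by
      conv_lhs => rw [← Rat.num_div_den y]
      rw [hden]; simp
    rw [hy, show ((y.num : ℚ)) = 0 + (y.num : ℚ) by ring, ratMinusSymbol_add_intCast, ratMinusSymbol_zero]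
    simp
  · have hcop : IsCoprime y.num (y.den : ℤ) := by
      rw [Int.isCoprime_iff_gcd_eq_one]
      exact y.reduced
    obtain ⟨u, v, huv⟩ := hcop
    have hden1 : (1 : ℤ) < y.den := by
      have := y.den_pos
      omega
    have hw : y.num * u % (y.den : ℤ) = 1 := by
      have : y.num * u = 1 + (y.den : ℤ) * (-v) := by linarith
      rw [this, Int.add_mul_emod_self_left, Int.emod_eq_of_lt (by norm_num) hden1]
    refine ⟨chainSum 389 phim389 (y.den + 1) y.den u, ?_⟩
    have h := hval y.num u y.den y.den_pos hw (y.den + 1) (by omega)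
    rw [Rat.num_div_den] at h
    rw [h]
    ring

/-! ## §6 The plus symbols of the newform of `T₀` -/

/-- `(u/7)` for `u < 7` as a table. [folklore] -/
def jac7 (u : ℕ) : ℤ := [0, 1, 1, -1, 1, -1, -1].getD u 0

/-- `jac7 u = (u/7)` for `u < 7` (decide). [folklore] -/
theorem jac7_eq : ∀ u < 7, jac7 u = jacobiSym u 7 := by
  intro u hu
  interval_cases u <;> norm_num [jac7]

/-- The Bezout witness `(7a + 211u)^{1259} mod 1477` (an inverse of `7a + 211u` modulo `1477 = 7·211`). [folklore] -/
def bezT (a u : ℕ) : ℤ := (((7 * a + 211 * u) ^ 1259 % 1477 : ℕ) : ℤ)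

/-- The kernel's twisted minus sum at `r = a/211`: `∑_{u=1}^{6} (u/7) · S⁻((7a + 211u)/1477)`.
[cite: MazurTateTeitelbaum1986Invent, §I.8] -/
def sigmaT (a : ℕ) : ℤ :=
  ∑ u : ZMod 7, (if u.val = 0 then 0 else jac7 u.val * chainSum 389 phim389 1478 1477 (bezT a u.val))

/-- Bezout data at `1477 = 7 · 211` (decide): `x · (x^{1259} mod 1477) ≡ 1` for `x = 7a + 211u`, `0 < a < 211`,
`a` prime to `211`, `1 ≤ u ≤ 6`. [folklore] -/
theorem bezout_1477 : ∀ a < 211, Nat.Coprime a 211 → ∀ u < 7, u ≠ 0 →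
    (((7 * a + 211 * u : ℕ) : ℤ) * bezT a u) % 1477 = 1 := by
  unfold bezT
  decide +kernel

/-- A modular parametrisation newform of `389a1` at level `389` exists, granted modularity BY NAME
(`exists_isNewformOf`; `N(389a1) = 389`). [cite: BreuilConradDiamondTaylor2001, Thm. A] -/
theorem exists_newform_389a1 (hnf : exists_isNewformOf) :
    ∃ f₀ : CuspForm (Gamma0 389) 2, IsNewformOf Curve389a1.E f₀ := by
  haveI := curve389a1_neZero_conductorNorm
  suffices h : ∀ N : ℕ, N = Curve389a1.E.conductorNorm ℤ → ∀ [NeZero N],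
      ∃ f₀ : CuspForm (Gamma0 N) 2, IsNewformOf Curve389a1.E f₀ from
    h 389 C389a1.conductorNorm_eq.symm
  intro N hN _
  subst hN
  exact hnf Curve389a1.E

/-- **The plus symbols of the newform `g` of `T₀` at level `19061`**: ONE rational `C` with `[r]⁺_g ∈ C ℤ` for
all `r` and `[a/211]⁺_g = C · sigmaT a` for `0 < a < 211` prime to `211` — from
`[r]⁺_{f₀⊗χ} = c ∑_u χ(u) [r + u/7]⁻_{f₀}` (`exists_rat_forall_ratPlusSymbol_charTwist_eq_of_odd`) and the certified
minus symbols of `f₀` (`exists_ratMinusSymbol_const`); modularity of `389a1` by name (`hnf`).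
[cite: MazurTateTeitelbaum1986Invent, §I.8] [cite: Shimura1971, Prop. 3.64] -/
theorem exists_const_T0 (hnf : exists_isNewformOf) (g : CuspForm (Gamma0 19061) 2)
    (hg : haveI := C389a1.minTwist7_isElliptic; IsNewformOf T0 g) :
    ∃ C : ℚ, (∀ r : ℚ, ∃ m : ℤ, ratPlusSymbol g r = C * m) ∧
      ∀ a < 211, Nat.Coprime a 211 → ratPlusSymbol g ((a : ℚ) / 211) = C * sigmaT a := by
  haveI := C389a1.minTwist7_isElliptic
  obtain ⟨f₀, hf₀⟩ := exists_newform_389a1 hnf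
  have hgF := newform_T0_eq_charTwist f₀ hf₀ g hg
  set F := charTwist 19061 dvd_19061 sq_dvd_19061 (isQuadratic_jacobiChar (q := 7)) f₀ with hFdef
  have hF : IsNewform0 F := hgF ▸ hg.1
  have hQF : coeffField F = ⊥ := hgF ▸ hg.coeffField_eq_bot
  obtain ⟨c, hc, -⟩ := exists_rat_forall_ratPlusSymbol_charTwist_eq_of_odd 19061 dvd_19061 sq_dvd_19061
    (isQuadratic_jacobiChar (q := 7)) jacobiChar_seven_odd jacobiChar_seven_isPrimitive hf₀.1
    hf₀.coeffField_eq_bot hF hQF (fun u : ZMod 7 => jacobiSym (u.val : ℤ) 7) (fun u => jacobiChar_apply u)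
  obtain ⟨K₀, hK₀all, hK₀val⟩ := exists_ratMinusSymbol_const f₀ hf₀
  refine ⟨c * K₀, fun r => ?_, fun a ha hac => ?_⟩
  · -- every `[r]⁺_g` is in `C ℤ`
    choose k hk using hK₀all
    refine ⟨∑ u : ZMod 7, jacobiSym (u.val : ℤ) 7 * k (r + twistShift u), ?_⟩
    rw [hgF, hc r]
    push_cast
    rw [Finset.mul_sum, Finset.mul_sum]
    refine Finset.sum_congr rfl fun u _ => ?_
    rw [hk (r + twistShift u)]
    ring
  · -- the value at `a/211`
    rw [hgF, hc ((a : ℚ) / 211)]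
    have hterm : ∀ u : ZMod 7, (jacobiSym (u.val : ℤ) 7 : ℚ) * ratMinusSymbol f₀ ((a : ℚ) / 211 + twistShift u) =
        K₀ * ((if u.val = 0 then 0 else jac7 u.val * chainSum 389 phim389 1478 1477 (bezT a u.val) : ℤ) : ℚ) := by
      intro u
      have hu7 : u.val < 7 := ZMod.val_lt u
      by_cases hu : u.val = 0
      · rw [hu, if_pos rfl]
        simp [jacobiSym.zero_left]
      · rw [if_neg hu, jac7_eq u.val hu7]
        have hbez := bezout_1477 a ha hac u.val hu7 hu
        have hval := hK₀val ((7 * a + 211 * u.val : ℕ) : ℤ) (bezT a u.val) 1477 (by norm_num) hbez 1478 (by norm_num)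
        have hr : (a : ℚ) / 211 + twistShift u = (((7 * a + 211 * u.val : ℕ) : ℤ) : ℚ) / (1477 : ℕ) := by
          rw [twistShift]
          push_cast
          field_simp
          ring
        rw [hr, hval]
        push_cast
        ring
    rw [Finset.sum_congr rfl fun u _ => hterm u, ← Finset.mul_sum, sigmaT, Int.cast_sum]
    ring

end Summit.BirchSwinnertonDyer.BirchSwinnertonDyer.Theorems.KolyvaginDepthDoor.MSymbolCert.Cert389a1

end
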